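import Summits.Ventures.CertifiedManyBodySolver.Downfold.ParameterBox
import HarnessLib

/-!
# Router input: interval data of a box (skeletons), closed windows and decision-table rows

Venture CertifiedManyBodySolver, cell `pub/hubbard-downfold` (HUMAN RULINGS D-0096/D-0098: stage S1 =
DOWNFOLDING FRONT END = ROUTER), seat hubbard-downfold-mod-2; namespaces
`Summit.Ventures.CertifiedManyBodySolver.Downfold` (`Skel`, `Box.skel`) and `….Downfold.Router`
(`Atom`, `Row`). Everything here is PROVED. WHAT THIS IS NOT: a certified statement about any
material, a physics threshold, or the cell's decision table of record (`pub/hubbard-downfold/ROUTER.md`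
§3, mirrored by `router/router.py`): this file and `Downfold.RouterWord` fix the SHAPE of a router —
a total function from interval data to a word or an `undetermined (reason)` — and prove the
bookkeeping facts every such table inherits.

* §1 `Skel ι := ι → Option (NonemptyInterval ℚ)` — what the router reads: per coordinate (box
  coordinate or descriptor, ROUTER.md §2) a rational interval or `none` = MISSING. Semantics in a
  linear ordered field `K` (`Skel.Mem`, via `NonemptyInterval.ratCast`); `Skel.Incl S S'` (`S'` is an
  INFLATION of `S`: Mathlib's `≤` = containment, coordinatewise; missing is the widest entry);
  `Skel.hull` (= `⊔` coordinatewise, never an average; `incl_hull_left/right`, `hull_least`);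
  `Skel.basePoint_mem` (a box is never empty); `Box.skel` reads the claimed enclosures of a
  `Downfold.Box` and `Box.mem_iff_skel_mem` identifies the two membership notions.
* §2 `Router.Atom` (closed WINDOW `[lo, hi]` on one coordinate, `none` = unbounded) and
  `Router.Row` (conjunction of windows ↦ word); decidable tests `Atom.inside` / `Atom.excluded`,
  `Row.fires` / `Row.excludedB` with soundness at every admitted vector (`inside_sound`,
  `excluded_sound`, `fires_sound`, `excludedB_sound`), monotonicity under box shrinking
  (`inside_mono`, `fires_mono`), and the decidable separation test `Row.separatedFrom`
  (`separatedFrom_sound`: separated rows never hold together) used for table consistency.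
-/

namespace Summit.Ventures.CertifiedManyBodySolver.Downfold

open NonemptyInterval

/-! ## §1 Interval data (skeletons) -/

/-- **Interval data read by the router**: per coordinate a rational interval, or `none` = MISSING
(not produced; constrains nothing). [folklore] -/
def Skel (ι : Type*) := ι → Option (NonemptyInterval ℚ)

namespace Skel

variable {ι : Type*} {K : Type*} [Field K] [LinearOrder K] [IsStrictOrderedRing K]

/-- A parameter vector `p` (coordinates in `K`) is ADMITTED: every present interval encloses its
coordinate. [folklore] -/
def Mem (S : Skel ι) (p : ι → K) : Prop := ∀ i I, S i = some I → p i ∈ I.ratCast K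

/-- `S.Incl S'`: `S'` is an INFLATION of `S` — every coordinate present in `S'` is present in `S`
with a sub-interval (missing is the widest entry). [folklore] -/
def Incl (S S' : Skel ι) : Prop := ∀ i I', S' i = some I' → ∃ I, S i = some I ∧ I ≤ I'

/-- Inflation is reflexive. [folklore] -/
theorem Incl.refl (S : Skel ι) : S.Incl S := fun _ I' h => ⟨I', h, le_rfl⟩

/-- Inflation is transitive. [folklore] -/
theorem Incl.trans {S₁ S₂ S₃ : Skel ι} (h₁ : S₁.Incl S₂) (h₂ : S₂.Incl S₃) : S₁.Incl S₃ := by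
  intro i I₃ h3
  obtain ⟨I₂, e2, l2⟩ := h₂ i I₃ h3
  obtain ⟨I₁, e1, l1⟩ := h₁ i I₂ e2
  exact ⟨I₁, e1, l1.trans l2⟩

/-- Inflation enlarges the admitted set. [folklore] -/
theorem Incl.mem_of_mem {S S' : Skel ι} (h : S.Incl S') {p : ι → K} (hp : S.Mem p) : S'.Mem p := by
  intro i I' hI'
  obtain ⟨I, hI, hle⟩ := h i I' hI'
  exact mem_ratCast_of_le hle (hp i I hI)

/-- The canonical witness vector (left end points; `0` where missing). [folklore] -/
def basePoint (S : Skel ι) (K : Type*) [Field K] [LinearOrder K] [IsStrictOrderedRing K] :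
    ι → K := fun i =>
  match S i with
  | some I => (I.fst : K)
  | none => 0

/-- The witness vector is admitted: a box is never empty. [folklore] -/
theorem basePoint_mem (S : Skel ι) : S.Mem (S.basePoint K) := by
  intro i I hI
  simp only [basePoint, hI, mem_ratCast_iff]
  exact ⟨le_rfl, Rat.cast_le.2 I.fst_le_snd⟩

/-- Coordinatewise HULL of two skeletons (two replays, disjunctive trust: hull, never average);
present only where both are. [folklore] -/
def hull (S₁ S₂ : Skel ι) : Skel ι := fun i =>
  match S₁ i, S₂ i with
  | some I, some J => some (I ⊔ J)
  | _, _ => none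

/-- The hull inflates its left argument. [folklore] -/
theorem incl_hull_left (S₁ S₂ : Skel ι) : S₁.Incl (S₁.hull S₂) := by
  intro i L
  rcases h1 : S₁ i with _ | I <;> rcases h2 : S₂ i with _ | J <;> simp [hull, h1, h2]
  rintro rfl
  exact le_sup_left

/-- The hull inflates its right argument. [folklore] -/
theorem incl_hull_right (S₁ S₂ : Skel ι) : S₂.Incl (S₁.hull S₂) := by
  intro i L
  rcases h1 : S₁ i with _ | I <;> rcases h2 : S₂ i with _ | J <;> simp [hull, h1, h2]
  rintro rfl
  exact le_sup_right

/-- The hull is the LEAST common inflation. [folklore] -/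
theorem hull_least {S₁ S₂ T : Skel ι} (h₁ : S₁.Incl T) (h₂ : S₂.Incl T) : (S₁.hull S₂).Incl T := by
  intro i L hL
  obtain ⟨I, eI, lI⟩ := h₁ i L hL
  obtain ⟨J, eJ, lJ⟩ := h₂ i L hL
  exact ⟨I ⊔ J, by simp [hull, eI, eJ], sup_le lI lJ⟩

/-- Widening one present coordinate to a super-interval (one INFLATION EVENT) is an inflation.
[folklore] -/
theorem incl_update [DecidableEq ι] {S : Skel ι} {i : ι} {I J : NonemptyInterval ℚ}
    (hI : S i = some I) (hIJ : I ≤ J) : S.Incl (Function.update S i (some J)) := by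
  intro j L hL
  by_cases hj : j = i
  · subst hj
    simp at hL
    subst hL
    exact ⟨I, hI, hIJ⟩
  · simp [hj] at hL
    exact ⟨L, hL, le_rfl⟩

end Skel

/-- **The interval data of a parameter box**: the claimed enclosure of every present entry.
[folklore] -/
def Box.skel {ι : Type*} (B : Box ι) : Skel ι := fun i => (B i).map Entry.encl

/-- A real parameter vector lies in a box iff the box's interval data admits it. [folklore] -/
theorem Box.mem_iff_skel_mem {ι : Type*} (B : Box ι) (p : ι → ℝ) : B.Mem p ↔ B.skel.Mem p := by
  constructor
  · intro h i I hI
    unfold Box.skel at hI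
    rcases hB : B i with _ | e
    · simp [hB] at hI
    · simp only [hB, Option.map_some, Option.some.injEq] at hI
      subst hI
      exact h i e hB
  · intro h i e he
    exact h i e.encl (by simp [Box.skel, he])

namespace Router

variable {ι : Type*} {K : Type*} [Field K] [LinearOrder K] [IsStrictOrderedRing K]

/-! ## §2 Windows and rows -/

/-- A closed acceptance WINDOW `[lo, hi]` on one coordinate (`none` = unbounded on that side).
[folklore] -/
structure Atom (ι : Type*) where
  /-- the coordinate tested -/
  coord : ι
  /-- lower end (`none` = `−∞`) -/
  lo : Option ℚ
  /-- upper end (`none` = `+∞`) -/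
  hi : Option ℚ

namespace Atom

/-- The vector `p` satisfies the window. [folklore] -/
def Sat (a : Atom ι) (p : ι → K) : Prop :=
  (∀ l, a.lo = some l → (l : K) ≤ p a.coord) ∧ (∀ h, a.hi = some h → p a.coord ≤ (h : K))

/-- The window's lower end lies below the interval. [folklore] -/
def loOk (a : Atom ι) (I : NonemptyInterval ℚ) : Bool :=
  match a.lo with
  | none => true
  | some l => decide (l ≤ I.fst)

/-- The window's upper end lies above the interval. [folklore] -/
def hiOk (a : Atom ι) (I : NonemptyInterval ℚ) : Bool :=
  match a.hi with
  | none => true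
  | some h => decide (I.snd ≤ h)

/-- INSIDE: the coordinate is present and its whole interval lies in the window. [folklore] -/
def inside (a : Atom ι) (S : Skel ι) : Bool :=
  match S a.coord with
  | none => false
  | some I => a.loOk I && a.hiOk I

/-- EXCLUDED: the coordinate is present and its interval misses the window. [folklore] -/
def excluded (a : Atom ι) (S : Skel ι) : Bool :=
  match S a.coord with
  | none => false
  | some I =>
    (match a.hi with | none => false | some h => decide (h < I.fst)) ||
    (match a.lo with | none => false | some l => decide (I.snd < l))

/-- Unfolding of `loOk`. [folklore] -/
theorem loOk_iff (a : Atom ι) (I : NonemptyInterval ℚ) :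
    a.loOk I = true ↔ ∀ l, a.lo = some l → l ≤ I.fst := by
  unfold loOk; cases a.lo <;> simp

/-- Unfolding of `hiOk`. [folklore] -/
theorem hiOk_iff (a : Atom ι) (I : NonemptyInterval ℚ) :
    a.hiOk I = true ↔ ∀ h, a.hi = some h → I.snd ≤ h := by
  unfold hiOk; cases a.hi <;> simp

/-- Unfolding of `inside`. [folklore] -/
theorem inside_iff (a : Atom ι) (S : Skel ι) :
    a.inside S = true ↔ ∃ I, S a.coord = some I ∧ a.loOk I = true ∧ a.hiOk I = true := by
  unfold inside
  cases S a.coord <;> simp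

/-- **An INSIDE window holds at every admitted vector.** [folklore] -/
theorem inside_sound {a : Atom ι} {S : Skel ι} (h : a.inside S = true) {p : ι → K}
    (hp : S.Mem p) : a.Sat p := by
  obtain ⟨I, hI, hlo, hhi⟩ := (inside_iff a S).1 h
  have hpI := mem_ratCast_iff.1 (hp a.coord I hI)
  refine ⟨fun l hl => ?_, fun u hu => ?_⟩
  · exact (Rat.cast_le.2 ((loOk_iff a I).1 hlo l hl)).trans hpI.1
  · exact hpI.2.trans (Rat.cast_le.2 ((hiOk_iff a I).1 hhi u hu))

/-- INSIDE is monotone under box shrinking. [folklore] -/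
theorem inside_mono {a : Atom ι} {S S' : Skel ι} (hSS' : S.Incl S') (h : a.inside S' = true) :
    a.inside S = true := by
  obtain ⟨I', hI', hlo, hhi⟩ := (inside_iff a S').1 h
  obtain ⟨I, hI, hle⟩ := hSS' a.coord I' hI'
  refine (inside_iff a S).2 ⟨I, hI, ?_, ?_⟩
  · exact (loOk_iff a I).2 fun l el => ((loOk_iff a I').1 hlo l el).trans hle.1
  · exact (hiOk_iff a I).2 fun u eu => hle.2.trans ((hiOk_iff a I').1 hhi u eu)

/-- **An EXCLUDED window fails at every admitted vector.** [folklore] -/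
theorem excluded_sound {a : Atom ι} {S : Skel ι} (h : a.excluded S = true) {p : ι → K}
    (hp : S.Mem p) : ¬ a.Sat p := by
  intro hsat
  unfold excluded at h
  rcases hS : S a.coord with _ | I
  · simp [hS] at h
  · have hpI := mem_ratCast_iff.1 (hp a.coord I hS)
    simp only [hS, Bool.or_eq_true] at h
    rcases h with h | h
    · rcases hh : a.hi with _ | u
      · simp [hh] at h
      · simp only [hh, decide_eq_true_eq] at h
        exact absurd ((hsat.2 u hh).trans_lt (Rat.cast_lt.2 h)) (not_lt.2 hpI.1)
    · rcases hl : a.lo with _ | l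
      · simp [hl] at h
      · simp only [hl, decide_eq_true_eq] at h
        exact absurd ((Rat.cast_lt.2 h).trans_le (hsat.1 l hl)) (not_lt.2 hpI.2)

/-- Two windows are DISJOINT (decidable). [folklore] -/
def disjointB (a b : Atom ι) : Bool :=
  (match a.hi, b.lo with | some h, some l => decide (h < l) | _, _ => false) ||
  (match b.hi, a.lo with | some h, some l => decide (h < l) | _, _ => false)

/-- Disjoint windows on the same coordinate are never satisfied together. [folklore] -/
theorem disjointB_sound {a b : Atom ι} (hc : a.coord = b.coord) (h : a.disjointB b = true)
    {p : ι → K} (ha : a.Sat p) : ¬ b.Sat p := by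
  intro hb
  unfold disjointB at h
  simp only [Bool.or_eq_true] at h
  have hb1 : ∀ l, b.lo = some l → (l : K) ≤ p a.coord := by rw [hc]; exact hb.1
  have hb2 : ∀ u, b.hi = some u → p a.coord ≤ (u : K) := by rw [hc]; exact hb.2
  rcases h with h | h
  · rcases e1 : a.hi with _ | u <;> rcases e2 : b.lo with _ | l <;> simp [e1, e2] at h
    exact absurd ((ha.2 u e1).trans_lt (Rat.cast_lt.2 h)) (not_lt.2 (hb1 l e2))
  · rcases e1 : b.hi with _ | u <;> rcases e2 : a.lo with _ | l <;> simp [e1, e2] at h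
    exact absurd ((hb2 u e1).trans_lt (Rat.cast_lt.2 h)) (not_lt.2 (ha.1 l e2))

end Atom

/-- **A ROW of a decision table**: a conjunction of windows and the word it emits. [folklore] -/
structure Row (ι ω : Type*) where
  /-- the windows -/
  atoms : List (Atom ι)
  /-- the word emitted when every window contains the box -/
  out : ω

namespace Row

variable {ω : Type*}

/-- The row FIRES on the box: every window is INSIDE. [folklore] -/
def fires (r : Row ι ω) (S : Skel ι) : Bool := r.atoms.all fun a => a.inside S

/-- The row is EXCLUDED on the box: some window is EXCLUDED. [folklore] -/
def excludedB (r : Row ι ω) (S : Skel ι) : Bool := r.atoms.any fun a => a.excluded S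

/-- Pointwise meaning of a row. [folklore] -/
def Sat (r : Row ι ω) (p : ι → K) : Prop := ∀ a ∈ r.atoms, a.Sat p

/-- A firing row holds at every admitted vector. [folklore] -/
theorem fires_sound {r : Row ι ω} {S : Skel ι} (h : r.fires S = true) {p : ι → K} (hp : S.Mem p) :
    r.Sat p := by
  intro a ha
  unfold fires at h
  rw [List.all_eq_true] at h
  exact Atom.inside_sound (h a ha) hp

/-- Firing is monotone under box shrinking. [folklore] -/
theorem fires_mono {r : Row ι ω} {S S' : Skel ι} (hSS' : S.Incl S') (h : r.fires S' = true) :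
    r.fires S = true := by
  unfold fires at h ⊢
  rw [List.all_eq_true] at h ⊢
  exact fun a ha => Atom.inside_mono hSS' (h a ha)

/-- An excluded row fails at every admitted vector. [folklore] -/
theorem excludedB_sound {r : Row ι ω} {S : Skel ι} (h : r.excludedB S = true) {p : ι → K}
    (hp : S.Mem p) : ¬ r.Sat p := by
  intro hsat
  unfold excludedB at h
  rw [List.any_eq_true] at h
  obtain ⟨a, ha, hex⟩ := h
  exact Atom.excluded_sound hex hp (hsat a ha)

/-- Rows are SEPARATED: disjoint windows on a common coordinate (decidable). [folklore] -/
def separatedFrom [DecidableEq ι] (r r' : Row ι ω) : Bool :=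
  r.atoms.any fun a => r'.atoms.any fun b => decide (a.coord = b.coord) && a.disjointB b

/-- Separated rows never hold at a common vector. [folklore] -/
theorem separatedFrom_sound [DecidableEq ι] {r r' : Row ι ω} (h : r.separatedFrom r' = true)
    {p : ι → K} (hr : r.Sat p) : ¬ r'.Sat p := by
  intro hr'
  unfold separatedFrom at h
  rw [List.any_eq_true] at h
  obtain ⟨a, ha, h⟩ := h
  rw [List.any_eq_true] at h
  obtain ⟨b, hb, h⟩ := h
  simp only [Bool.and_eq_true, decide_eq_true_eq] at h
  exact Atom.disjointB_sound h.1 h.2 (hr a ha) (hr' b hb)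

end Row

end Router

end Summit.Ventures.CertifiedManyBodySolver.Downfold
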